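import Summits.HodgeConjecture.HodgeConjecture.Theorems.MarkmanPartnerTransportPicardThreeK3SquaresRMTypeOpenExists
import Summits.HodgeConjecture.HodgeConjecture.Theorems.MarkmanPartnerTransportPicardThreeK3SquaresRMTypeOpenByName
import Literature.AlgebraicGeometry.Surfaces.K3TwistorLines
import HarnessLib

/-!
# Route MarkmanPartnerTransport · crux `PicardThreeK3Squares` (stmt-HodgeConjecture-19652) —
# the Hodge locus of an RM class lives in ONE eigenvalue; (T‴) the discharger's form of the open-set descent

Cell hodge-nonav, crux #4 (HC⁴(S ⊗ S), ρ(S) ≥ 3; open core: real multiplication), programme «RATIONAL ORBIT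
DENSITY» (prover seat hodge-nonav-19652-p1 gen 10; `--supports stmt-HodgeConjecture-19652`, helper).
CONDITIONAL on the named fact `Buskin2019_hodgeIsometry_algebraic` and a DISPLAYED single-eigenvalue,
∃-form open-set input; credits nothing; nothing here says HC is proved.

* `eigenvalue_eq_of_periodPts` — **EIGENVALUE UNIQUENESS** (fact-free): if `θ ∈ M₂₂(ℚ)` is
  `k3Form`-self-adjoint and kills a rational vector of positive square, two period points of `Λ_ℂ` that are
  `θ_ℂ`-eigenvectors with non-zero real eigenvalues have the SAME eigenvalue (else `Re y, Im y, Re y′, Im y′,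
  u` is an orthogonal positive `5`-frame in signature `(3,19)`; `finrank_le_three_of_posDef_k3`). So the
  displayed input `RMTypeOpen θ` ∕ `Open[θ, e]` need only be supplied at ONE eigenvalue.
* `generic_and_posKernel_of_marking` — for a marked projective K3 surface, an endomorphism `t` killing
  `N¹(S)` and a rational isometry `σ` with `σηt = θ_ℂση`: `σx` is `θ`-generic and `θ` kills the positive
  rational vector `σu` (Lefschetz `(1,1)`).
* **`hodgeConjectureFor_square_of_exists_on_open_at` — (T‴), THE DISCHARGER'S FORM**: `θ` self-adjoint,
  `e₀ ≠ 0` real, an open `U ∋ y₁ ∈ D_{θ,e₀}` with `CycleEx[θ, e₀, U]` («at every `θ`-generic period of `U`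
  some marked K3 surface carries a cycle inducing `θ`» — the shape of «open period image of a maximal van
  Geemen–Schütt family + §4.8 cycle on every member») ⟹ `HodgeConjectureFor 4 (S ⊗ S)` for EVERY RM K3
  surface `S` (`IsRealMultiplicationK3 S ρ P`, `P` separable, `P(0) ≠ 0`) whose admissible generator is
  conjugate by a rational isometry to `θ` — the eigenvalue of `S` is pinned to `e₀` by uniqueness, the
  certificate comes from `P` (`exists_eigenprojector_certificate`), and (T″)
  `hodgeConjectureFor_square_of_exists_on_open` applies. Mod Buskin ONLY.

No definition, no sorry.

References: van Geemen–Schütt, Forum Math. Sigma 13 (2025) e2, §2.1, §3.4, Thm. 1.1 (9), (11), Thm. 1.2 (2),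
§4.8; Buskin, J. reine angew. Math. 755 (2019), Thm. 1.1; Huybrechts, *Lectures on K3 Surfaces*, Ch. 1
Prop. 3.5, Ch. 6 Prop. 1.5, Ch. 14 §0.3 (vi); Serre, *A Course in Arithmetic*, Ch. IV §2.4.
-/

set_option linter.dupNamespace false

noncomputable section

namespace Summit.HodgeConjecture.HodgeConjecture.Theorems.MarkmanPartnerTransport.RMTypeOrbit

open CategoryTheory MonoidalCategory Polynomial
open Literature.AlgebraicGeometry Literature.AlgebraicGeometry.Motives Literature.AlgebraicGeometry.HodgeTheory
open Literature.AlgebraicGeometry.Surfaces Literature.LinearAlgebra.QuadraticForm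
open Literature.AlgebraicTopology.SingularHomology
open Summit.HodgeConjecture.HodgeConjecture.Theorems.NikulinTwinTransport
open Summit.HodgeConjecture.HodgeConjecture.Theorems.MarkmanPartnerTransport.IsogenyInvariance
open Summit.HodgeConjecture.HodgeConjecture.Theorems.MarkmanPartnerTransport.RMTypeDescent

/-- `MarkedK3[S, η, p, x]`: VERBATIM the `let MarkedK3 := …` binder of the route declaration
`PicardThreeK3Squares` (as in `…RMTypeDescent`). Local notation only. -/
local notation3 (prettyPrint := false) "MarkedK3[" S ", " η ", " p ", " x "]" =>
  (p ≠ 0 ∧ (IsIntegralClass p ∧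
    (∀ q : complexBetti S (2 * 2), IsIntegralClass q → ∃ n : ℤ, q = n • p) ∧
    (∀ c : complexBetti S (2 * 1), IsIntegralClass c ↔ ∃ v : K3Index → ℤ, η c = fun i => (v i : ℂ)) ∧
    (∀ a b : complexBetti S (2 * 1),
      cupProduct (rfl : 2 * 1 + 2 * 1 = 2 * 2) a b = k3Form (η a) (η b) • p) ∧
    IsOfHodgeType 2 S (2 * 1) 2 0 (LinearEquiv.symm η x) ∧
    (∀ τ : complexBetti S (2 * 1), IsOfHodgeType 2 S (2 * 1) 2 0 τ →
      ∃ t : ℂ, τ = t • LinearEquiv.symm η x)) ∧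
    (k3Form x x = 0 ∧ 0 < (k3Form (star x) x).re ∧
      ∃ u : K3Index → ℤ, k3Form (fun i => (u i : ℂ)) x = 0 ∧ 0 < ∑ i, ∑ j, u i * k3Gram i j * u j))

/-- `CycleEx[θ, e, U]`: the ∃-form of `Cycle[θ, e, U]` — at every `θ`-generic period point of `D_{θ,e}`
in `U` there EXISTS a marked projective K3 surface carrying an algebraic class inducing `η'⁻¹ θ_ℂ η'` (the
shape of a family fact: «every period in the open period set of the family is the period of a member, and
every member carries the cycle»). Local notation only. -/
local notation3 (prettyPrint := false) "CycleEx[" θ ", " e ", " U "]" =>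
  (∀ y : K3Index → ℂ, y ∈ U → thetaC θ y = (e : ℂ) • y → k3Form y y = 0 → 0 < (k3Form (star y) y).re →
    (∀ v : K3Index → ℚ, k3Form (fun i => (v i : ℂ)) y = 0 → Matrix.mulVec θ v = 0) →
    ∃ (S' : SchemeOver ℂ) (hS' : IsK3Surface S') (η' : complexBetti S' (2 * 1) ≃ₗ[ℂ] (K3Index → ℂ))
      (p' : complexBetti S' (2 * 2)), MarkedK3[S', η', p', y] ∧
      ∃ γ' ∈ algebraicClasses (S' ⊗ S') 2, ∀ z : complexBetti S' (2 * 1),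
        (η'.symm.toLinearMap ∘ₗ (thetaC θ ∘ₗ η'.toLinearMap)) z =
          complexGysin complexOrientationFamily
            (IsSmoothProjective.tensor_holds hS'.isSmoothProjective hS'.isSmoothProjective)
            hS'.isSmoothProjective (SemiCartesianMonoidalCategory.fst S' S')
            (rfl : 2 * 1 + 2 * 2 + 2 * 2 = 2 * 1 + 2 * (2 + 2))
            (cupProduct (rfl : 2 * 1 + 2 * 2 = 2 * 1 + 2 * 2)
              (complexBetti.map (SemiCartesianMonoidalCategory.snd S' S') (2 * 1) z) γ'))

variable {S : SchemeOver ℂ} {θ : Matrix K3Index K3Index ℚ}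

/-- **The Hodge locus of a real-multiplication class lives in ONE eigenvalue.** If `θ ∈ M₂₂(ℚ)` is
`k3Form`-self-adjoint and kills a rational vector of positive square, then two period points
(`(y.y) = 0`, `(ȳ.y) > 0`) which are `θ_ℂ`-eigenvectors with NON-ZERO real eigenvalues `e, e'` have
`e = e'`: otherwise `Re y, Im y, Re y', Im y', u` would be an orthogonal family of five vectors of positive
square in `Λ_ℝ` of signature `(3,19)`. [cite: Huybrechts2016K3, Ch. 6 Prop. 1.5 and Ch. 14 §0.3 (vi)]
[cite: GeemenSchutt2023, §2.1] -/
theorem eigenvalue_eq_of_periodPts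
    (hθsa : ∀ a b : K3Index → ℂ, k3Form (thetaC θ a) b = k3Form a (thetaC θ b))
    (hu : ∃ u : K3Index → ℚ, θ.mulVec u = 0 ∧ 0 < k3FormRat u u)
    {e e' : ℝ} (he : e ≠ 0) (he' : e' ≠ 0) {y y' : K3Index → ℂ}
    (hy : thetaC θ y = (e : ℂ) • y) (hyy : k3Form y y = 0) (hyp : 0 < (k3Form (star y) y).re)
    (hy' : thetaC θ y' = (e' : ℂ) • y') (hy'y' : k3Form y' y' = 0) (hy'p : 0 < (k3Form (star y') y').re) :
    e = e' := by
  classical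
  by_contra hne
  obtain ⟨u, hu0, hupos⟩ := hu
  obtain ⟨hC, hAB, hA⟩ := k3Period_re_im hyy hyp
  obtain ⟨hC', hAB', hA'⟩ := k3Period_re_im hy'y' hy'p
  have hre : star (e : ℂ) = e := Complex.conj_ofReal e
  have hre' : star (e' : ℂ) = e' := Complex.conj_ofReal e'
  have h1 := thetaC_reV_of_eigen hre hy
  have h2 := thetaC_imV_of_eigen hre hy
  have h1' := thetaC_reV_of_eigen hre' hy'
  have h2' := thetaC_imV_of_eigen hre' hy'
  -- eigenvectors for `e ≠ e'` are orthogonal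
  have hcross : ∀ a b : K3Index → ℂ, thetaC θ a = (e : ℂ) • a → thetaC θ b = (e' : ℂ) • b →
      k3Form a b = 0 := by
    intro a b ha hb
    have h := hθsa a b
    rw [ha, hb, k3Form_smul_left, k3Form_smul_right] at h
    have h3 : ((e : ℂ) - e') * k3Form a b = 0 := by rw [sub_mul, h, sub_self]
    rcases mul_eq_zero.1 h3 with h0 | h0
    · exact absurd (by exact_mod_cast sub_eq_zero.1 h0) hne
    · exact h0
  -- `u` is orthogonal to eigenvectors with non-zero eigenvalue
  set uC : K3Index → ℂ := fun i => ((u i : ℝ) : ℂ) with huC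
  have huC' : uC = fun i => (u i : ℂ) := by
    funext i; exact Complex.ofReal_ratCast (u i)
  have huorth : ∀ (a : K3Index → ℂ) (c : ℝ), c ≠ 0 → thetaC θ a = (c : ℂ) • a → k3Form uC a = 0 := by
    intro a c hc ha
    have h := hθsa (fun i => (u i : ℂ)) a
    rw [thetaC_ratCast, hu0, ha, k3Form_smul_right] at h
    have h0 : k3Form (fun i => ((0 : K3Index → ℚ) i : ℂ)) a = 0 := by
      have : (fun i => ((0 : K3Index → ℚ) i : ℂ)) = 0 := by funext i; simp
      rw [this, k3Form_zero_left]
    rw [h0] at h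
    rw [huC']
    rcases mul_eq_zero.1 h.symm with h' | h'
    · exact absurd (by exact_mod_cast h') hc
    · exact h'
  -- the real family of five orthogonal positive vectors
  set BR : LinearMap.BilinForm ℝ (K3Index → ℝ) := Matrix.toBilin' (k3Gram.map (Int.cast : ℤ → ℝ)) with hBR
  have hRs : BR.IsSymm := by
    rw [hBR]
    exact Matrix.isSymm_toBilin'_iff_isSymm.mpr (Matrix.IsSymm.map k3Gram_transpose _)
  set r0 : K3Index → ℝ := fun i => (y i).re with hr0
  set r1 : K3Index → ℝ := fun i => (y i).im with hr1
  set r2 : K3Index → ℝ := fun i => (y' i).re with hr2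
  set r3 : K3Index → ℝ := fun i => (y' i).im with hr3
  set r4 : K3Index → ℝ := fun i => (u i : ℝ) with hr4
  have hc0 : (fun i => (r0 i : ℂ)) = reV y := rfl
  have hc1 : (fun i => (r1 i : ℂ)) = imV y := rfl
  have hc2 : (fun i => (r2 i : ℂ)) = reV y' := rfl
  have hc3 : (fun i => (r3 i : ℂ)) = imV y' := rfl
  have hc4 : (fun i => (r4 i : ℂ)) = uC := rfl
  have hread : ∀ v w : K3Index → ℝ, k3Form (fun i => (v i : ℂ)) (fun i => (w i : ℂ)) = 0 → BR v w = 0 := by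
    intro v w h
    rw [k3Form_ofReal_eq_k3RForm] at h
    exact_mod_cast h
  have o01 : BR r0 r1 = 0 := hread _ _ (by rw [hc0, hc1, k3Form_reV_imV, hC, Complex.ofReal_zero])
  have o02 : BR r0 r2 = 0 := hread _ _ (by rw [hc0, hc2]; exact hcross _ _ h1 h1')
  have o03 : BR r0 r3 = 0 := hread _ _ (by rw [hc0, hc3]; exact hcross _ _ h1 h2')
  have o04 : BR r0 r4 = 0 := hread _ _ (by rw [hc0, hc4, k3Form_comm]; exact huorth _ e he h1)
  have o12 : BR r1 r2 = 0 := hread _ _ (by rw [hc1, hc2]; exact hcross _ _ h2 h1')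
  have o13 : BR r1 r3 = 0 := hread _ _ (by rw [hc1, hc3]; exact hcross _ _ h2 h2')
  have o14 : BR r1 r4 = 0 := hread _ _ (by rw [hc1, hc4, k3Form_comm]; exact huorth _ e he h2)
  have o23 : BR r2 r3 = 0 := hread _ _ (by rw [hc2, hc3, k3Form_reV_imV, hC', Complex.ofReal_zero])
  have o24 : BR r2 r4 = 0 := hread _ _ (by rw [hc2, hc4, k3Form_comm]; exact huorth _ e' he' h1')
  have o34 : BR r3 r4 = 0 := hread _ _ (by rw [hc3, hc4, k3Form_comm]; exact huorth _ e' he' h2')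
  have o10 : BR r1 r0 = 0 := by rw [hRs.eq]; exact o01
  have o20 : BR r2 r0 = 0 := by rw [hRs.eq]; exact o02
  have o30 : BR r3 r0 = 0 := by rw [hRs.eq]; exact o03
  have o40 : BR r4 r0 = 0 := by rw [hRs.eq]; exact o04
  have o21 : BR r2 r1 = 0 := by rw [hRs.eq]; exact o12
  have o31 : BR r3 r1 = 0 := by rw [hRs.eq]; exact o13
  have o41 : BR r4 r1 = 0 := by rw [hRs.eq]; exact o14
  have o32 : BR r3 r2 = 0 := by rw [hRs.eq]; exact o23
  have o42 : BR r4 r2 = 0 := by rw [hRs.eq]; exact o24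
  have o43 : BR r4 r3 = 0 := by rw [hRs.eq]; exact o34
  -- positivity
  have p0 : 0 < BR r0 r0 := by rw [hBR, toBilin'_k3Gram_real_apply]; exact hA
  have p1 : 0 < BR r1 r1 := by rw [hBR, toBilin'_k3Gram_real_apply, ← hAB]; exact hA
  have p2 : 0 < BR r2 r2 := by rw [hBR, toBilin'_k3Gram_real_apply]; exact hA'
  have p3 : 0 < BR r3 r3 := by rw [hBR, toBilin'_k3Gram_real_apply, ← hAB']; exact hA'
  have p4 : 0 < BR r4 r4 := by
    have h : BR r4 r4 = ((k3FormRat u u : ℚ) : ℝ) := by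
      rw [hBR, toBilin'_k3Gram_real_apply, k3FormRat_apply]
      push_cast
      rfl
    rw [h]
    exact_mod_cast hupos
  have hO : BR.iIsOrtho ![r0, r1, r2, r3, r4] := by
    rw [LinearMap.BilinForm.iIsOrtho_def]
    intro i j hij
    fin_cases i <;> fin_cases j <;>
      first
      | exact absurd rfl hij
      | simp [o01, o02, o03, o04, o12, o13, o14, o23, o24, o34, o10, o20, o30, o40, o21, o31, o41, o32,
          o42, o43]
  have hposk : ∀ k, 0 < BR (![r0, r1, r2, r3, r4] k) (![r0, r1, r2, r3, r4] k) := by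
    intro k
    fin_cases k
    · simpa using p0
    · simpa using p1
    · simpa using p2
    · simpa using p3
    · simpa using p4
  have h5 := finrank_span_of_iIsOrtho BR hO hposk
  have h3 := finrank_le_three_of_posDef_k3 _ (posDef_restrict_span_of_iIsOrtho BR hO hposk)
  rw [h5, Fintype.card_fin] at h3
  omega



/-- **`θ`-genericity of the transported period and a positive rational vector killed by `θ`** (Lefschetz
`(1,1)` on `S`): for a marked projective K3 surface `(S, η, p, x)`, an endomorphism `t` killing `N¹(S)`
and a rational isometry `σ` with `σ η t = θ_ℂ σ η`, every rational vector orthogonal to `σ x` is killed by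
`θ`, and `θ` kills the image `σ u` of the marking's positive integral vector `u ⊥ x`.
[cite: Huybrechts2016K3, Ch. 1 Prop. 3.5, Ch. 3 §3.2 (Lefschetz (1,1))] [cite: GeemenSchutt2023, §2.1] -/
theorem generic_and_posKernel_of_marking
    {θ : Matrix K3Index K3Index ℚ} (hS : IsK3Surface S)
    (η : complexBetti S (2 * 1) ≃ₗ[ℂ] (K3Index → ℂ)) (p : complexBetti S (2 * 2)) (x : K3Index → ℂ)
    (hM : MarkedK3[S, η, p, x])
    (t : complexBetti S (2 * 1) →ₗ[ℂ] complexBetti S (2 * 1)) (ht_N : ∀ d ∈ algebraicClasses S 1, t d = 0)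
    (σ : Module.End ℂ (K3Index → ℂ)) (hσ : ∀ a b, k3Form (σ a) (σ b) = k3Form a b)
    (hσrat : ∀ v : K3Index → ℤ, ∃ w : K3Index → ℚ, σ (fun i => (v i : ℂ)) = fun i => (w i : ℂ))
    (hconj : ∀ c : complexBetti S (2 * 1), σ (η (t c)) = thetaC θ (σ (η c))) :
    (∀ v : K3Index → ℚ, k3Form (fun i => (v i : ℂ)) (σ x) = 0 → θ.mulVec v = 0) ∧
      ∃ w : K3Index → ℚ, θ.mulVec w = 0 ∧ 0 < k3FormRat w w := by
  classical
  have hHT : Huybrechts_K3_hodgeTypes_H2 := Huybrechts_K3_hodgeTypes_H2_holds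
  obtain ⟨hp0, ⟨hpint, hpgen, hηint, hηcup, h20, hline⟩, hPer⟩ := hM
  have hxpos : 0 < (k3Form (star x) x).re := hPer.2.1
  have hx0 : η.symm x ≠ 0 := fun h0 =>
    ne_zero_of_star_self_re_pos hxpos (by simpa using congrArg η h0)
  obtain ⟨σ', hσσ', -, -, hσ'rat⟩ := exists_inverse_ratIsometry σ hσ hσrat
  have hgenσ : ∀ v : K3Index → ℚ, k3Form (fun i => (v i : ℂ)) (σ x) = 0 → θ.mulVec v = 0 := by
    intro v hv
    obtain ⟨w, hw⟩ := ratEnd_ratCast σ' hσ'rat v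
    have hwx : k3Form (fun i => (w i : ℂ)) x = 0 := by
      rw [← hw, ← hσ (σ' _) x, hσσ']
      exact hv
    have hwx' : k3Form (fun i => (w i : ℂ)) (star x) = 0 := by
      have hreal : star (fun i => (w i : ℂ)) = fun i => (w i : ℂ) := by
        funext i
        simp only [Pi.star_apply, Complex.star_def, map_ratCast]
      have h := congrArg star hwx
      rwa [star_k3Form, hreal, star_zero] at h
    have hcrat : IsRationalClass (η.symm fun i => (w i : ℂ)) :=
      (isRationalClass_iff_of_marking hS η hηint _).2 ⟨w, η.apply_symm_apply _⟩
    have hc11 : IsOfHodgeType 2 S (2 * 1) 1 1 (η.symm fun i => (w i : ℂ)) := by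
      obtain ⟨-, -, h3⟩ := hHT S hS (η.symm x) h20 hx0
      refine (h3 _).2 ⟨?_, ?_⟩
      · rw [hηcup, η.apply_symm_apply, η.apply_symm_apply, hwx, zero_smul]
      · rw [conjClass_marking_symm η hηint, hηcup, η.apply_symm_apply, η.apply_symm_apply, hwx', zero_smul]
    have hcalg : (η.symm fun i => (w i : ℂ)) ∈ algebraicClasses S 1 :=
      lefschetzOneOne_rational_holds hS.isSmoothProjective _ hcrat hc11
    have h1 := hconj (η.symm fun i => (w i : ℂ))
    rw [ht_N _ hcalg, map_zero, map_zero, η.apply_symm_apply, ← hw, hσσ', thetaC_ratCast] at h1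
    funext i
    have h2 := congrFun h1 i
    simp only [Pi.zero_apply] at h2
    exact_mod_cast h2.symm
  refine ⟨hgenσ, ?_⟩
  obtain ⟨u, hux, hupos⟩ := hPer.2.2
  obtain ⟨w, hw⟩ := hσrat u
  refine ⟨w, hgenσ w (by rw [← hw, hσ, hux]), ?_⟩
  have h1 : (k3FormRat w w : ℚ) = ((∑ i, ∑ j, u i * k3Gram i j * u j : ℤ) : ℚ) := by
    apply Rat.cast_injective (α := ℂ)
    rw [← k3Form_ratCast, ← hw, hσ, intCast_eq_ratCast_intCast, k3Form_ratCast, k3FormRat_intCast]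
  rw [h1]
  exact_mod_cast hupos

/-- **(T‴) THE DISCHARGER'S FORM — one eigenvalue, ∃-form, RM data only.** Let `θ ∈ M₂₂(ℚ)` be
`k3Form`-self-adjoint and `e₀ ≠ 0` real; suppose an open `U ⊂ Λ_ℂ` contains a period point `y₁` of the
Hodge locus `D_{θ,e₀}` and that at every `θ`-generic period point of `U ∩ D_{θ,e₀}` SOME marked projective
K3 surface carries an algebraic class inducing `θ` (`CycleEx[θ, e₀, U]`; the shape of «open period image of
a maximal family + cycle on every member»). Then EVERY RM K3 surface `S` (`IsRealMultiplicationK3 S ρ P`,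
`P` separable with `P(0) ≠ 0`) marked by `(η, p, x)`, with admissible generator `t` conjugate by a rational
isometry `σ` to `θ`, satisfies `HodgeConjectureFor 4 (S ⊗ S)`: the `(2,0)`-eigenvalue of `t` is a non-zero
real root of `P` and EQUALS `e₀` (`eigenvalue_eq_of_periodPts`: the Hodge locus of `θ` lives in one
eigenvalue), the eigenprojector certificate comes from `P`, and (T″)
`hodgeConjectureFor_square_of_exists_on_open` applies. CONDITIONAL on `Buskin2019_hodgeIsometry_algebraic`
and the displayed open-set input ONLY; credits nothing; HC is NOT proved here.
[cite: GeemenSchutt2023, §2.1, §3.4, Thm. 1.1 (9), (11), Thm. 1.2 (2) and §4.8] [cite: Buskin2019, Thm. 1.1]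
[cite: Huybrechts2016K3, Ch. 6 Prop. 1.5 and Ch. 14 §0.3 (vi)] -/
theorem hodgeConjectureFor_square_of_exists_on_open_at
    (hB : Buskin2019_hodgeIsometry_algebraic)
    (hθsa : ∀ a b : K3Index → ℂ, k3Form (thetaC θ a) b = k3Form a (thetaC θ b))
    {e₀ : ℝ} (he₀ : e₀ ≠ 0) {U : Set (K3Index → ℂ)} (hU : IsOpen U)
    {y₁ : K3Index → ℂ} (hy₁U : y₁ ∈ U) (hy₁ : thetaC θ y₁ = (e₀ : ℂ) • y₁) (h₁₁ : k3Form y₁ y₁ = 0)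
    (h₁p : 0 < (k3Form (star y₁) y₁).re) (hcyc : CycleEx[θ, e₀, U])
    {S : SchemeOver ℂ} {ρ : ℕ} {P : ℚ[X]} (h : IsRealMultiplicationK3 S ρ P)
    (hPsep : P.Separable) (hP0 : P.eval 0 ≠ 0)
    (η : complexBetti S (2 * 1) ≃ₗ[ℂ] (K3Index → ℂ)) (p : complexBetti S (2 * 2)) (x : K3Index → ℂ)
    (hM : MarkedK3[S, η, p, x])
    (t : complexBetti S (2 * 1) →ₗ[ℂ] complexBetti S (2 * 1))
    (ht_rat : ∀ y, IsRationalClass y → IsRationalClass (t y))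
    (ht_typ : ∀ (i j : ℕ) (y : complexBetti S (2 * 1)),
      IsOfHodgeType 2 S (2 * 1) i j y → IsOfHodgeType 2 S (2 * 1) i j (t y))
    (ht_N : ∀ d ∈ algebraicClasses S 1, t d = 0)
    (ht_perp : ∀ (y : complexBetti S (2 * 1)), ∀ d ∈ algebraicClasses S 1,
      cupProduct (rfl : 2 * 1 + 2 * 1 = 2 * 2) (t y) d = 0)
    (hP : IsAnnihilatedOnTranscendentalBy S t P) (hgen : TranscendentalEndomorphismsGeneratedBy S t)
    (σ : Module.End ℂ (K3Index → ℂ)) (hσ : ∀ a b, k3Form (σ a) (σ b) = k3Form a b)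
    (hσrat : ∀ v : K3Index → ℤ, ∃ w : K3Index → ℚ, σ (fun i => (v i : ℂ)) = fun i => (w i : ℂ))
    (hconj : ∀ c : complexBetti S (2 * 1), σ (η (t c)) = thetaC θ (σ (η c))) :
    HodgeConjectureFor 4 (S ⊗ S) := by
  classical
  have hS : IsK3Surface S := h.isK3Surface
  have hHT : Huybrechts_K3_hodgeTypes_H2 := Huybrechts_K3_hodgeTypes_H2_holds
  obtain ⟨hgenσ, hw⟩ := generic_and_posKernel_of_marking hS η p x hM t ht_N σ hσ hσrat hconj
  obtain ⟨hp0, ⟨hpint, hpgen, hηint, hηcup, h20, hline⟩, hPer⟩ := hM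
  have hxpos : 0 < (k3Form (star x) x).re := hPer.2.1
  have hx0 : η.symm x ≠ 0 := fun h0 =>
    ne_zero_of_star_self_re_pos hxpos (by simpa using congrArg η h0)
  -- the `(2,0)`-eigenvalue `e'` of `t`: real, a root of `P`, non-zero
  obtain ⟨e', he'⟩ := hline (t (η.symm x)) (ht_typ 2 0 _ h20)
  have heig' : thetaC θ (σ x) = e' • σ x := by
    have h1 := hconj (η.symm x)
    rw [he', map_smul, LinearEquiv.apply_symm_apply, map_smul] at h1
    exact h1.symm
  have hPσ := periodPt_ratIsometry σ hσ hσrat hPer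
  have hstar : star e' = e' := star_eigenvalue_eq hθsa heig' hPσ.2.1
  have hee : ((e'.re : ℝ) : ℂ) = e' := Complex.conj_eq_iff_re.1 hstar
  set PC : ℂ[X] := P.map (algebraMap ℚ ℂ) with hPC
  have htransc : ∀ d ∈ algebraicClasses S 1, cupProduct (rfl : 2 * 1 + 2 * 1 = 2 * 2) (η.symm x) d = 0 := by
    intro d hd
    obtain ⟨-, -, h3⟩ := hHT S hS (η.symm x) h20 hx0
    have h11 : IsOfHodgeType 2 S (2 * 1) 1 1 d :=
      isOfHodgeType_of_mem_algebraicClasses_of_isSmoothProjective hS.isSmoothProjective 1 hd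
    have hds := ((h3 d).1 h11).1
    rw [cupProduct_gradedComm_holds ℂ _ (rfl : 2 * 1 + 2 * 1 = 2 * 2) rfl]
    norm_num
    exact hds
  have hroot : PC.IsRoot e' := by
    have h1 := hP (η.symm x) htransc
    rw [← hPC, aeval_apply_of_eigen he', smul_eq_zero] at h1
    exact h1.resolve_right hx0
  have he'0 : e'.re ≠ 0 := by
    intro hz
    have h0 : e' = 0 := by rw [← hee, hz, Complex.ofReal_zero]
    have h1 : PC.eval 0 = 0 := by
      have h2 : PC.eval e' = 0 := hroot
      rwa [h0] at h2
    rw [hPC, Polynomial.eval_map, Polynomial.eval₂_at_zero, map_eq_zero_iff _ (algebraMap ℚ ℂ).injective,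
      Polynomial.coeff_zero_eq_eval_zero] at h1
    exact hP0 h1
  -- the Hodge locus of `θ` lives in one eigenvalue: `e'.re = e₀`
  have heq : e'.re = e₀ :=
    eigenvalue_eq_of_periodPts hθsa hw he'0 he₀ (by rw [hee]; exact heig') hPσ.1 hPσ.2.1 hy₁ h₁₁ h₁p
  have hee₀ : (e₀ : ℂ) = e' := by rw [← heq]; exact hee
  -- annihilation and certificate at `e₀`
  have htP : aeval t (X * PC) = 0 := by
    refine LinearMap.ext fun y => ?_
    rw [mul_comm X PC, map_mul, aeval_X, Module.End.mul_apply, LinearMap.zero_apply]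
    exact hP (t y) (ht_perp y)
  have hσsurj : Function.Surjective σ :=
    LinearMap.surjective_of_injective (injective_of_k3Form_isometry σ hσ)
  have hθP : aeval (thetaC θ) (X * PC) = 0 := by
    refine LinearMap.ext fun y => ?_
    obtain ⟨z, rfl⟩ := hσsurj y
    obtain ⟨c, rfl⟩ : ∃ c, η c = z := ⟨η.symm z, η.apply_symm_apply z⟩
    rw [LinearMap.zero_apply, ← conj_aeval_apply η t σ hconj, htP, LinearMap.zero_apply, map_zero, map_zero]
  obtain ⟨π, hπe, hπW⟩ := exists_eigenprojector_certificate (thetaC θ) (hPsep.map) hθP hroot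
  rw [← hee₀] at hπe hπW he'
  exact hodgeConjectureFor_square_of_exists_on_open hB hθsa he₀ hπe hπW
    (fun _ _ _ _ _ => ⟨U, hU, ⟨y₁, hy₁U, hy₁, h₁₁, h₁p⟩, hcyc⟩) hS η p x
    ⟨hp0, ⟨hpint, hpgen, hηint, hηcup, h20, hline⟩, hPer⟩ t ht_rat ht_N he' hgen σ hσ hσrat hconj

end Summit.HodgeConjecture.HodgeConjecture.Theorems.MarkmanPartnerTransport.RMTypeOrbit

end
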